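import Summits.BirchSwinnertonDyer.Rank1Residual.AdditivePotMult.TwistSupplyX4
import HarnessLib

/-!
# X3♯(M) and X4(M) ∧ (ram): for every pair there is ONE quadratic field `K` over which
# `BSD(E,p)` is EQUIVALENT to the typed over-`K` input

HONEST FRAMING (cell `b2b-bsdres`, run/shared/lean/b2b/bsd-rank1-residual/, verbatim in every
file): the goal of the cell is to DELETE the COMBINATION-SHAPED residual classes of the
Birch–Swinnerton-Dyer formula for ALL analytic-rank `≤ 1` elliptic curves over `ℚ` — "full BSD
formula for every rank `≤ 1` curve in class `C`" assembled STRICTLY from published theorems — so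
that the rank-`≤ 1` remainder becomes exactly the CONSTRUCTION-SHAPED classes, which are TYPED
(missing-input `Prop`s), NOT attempted. This is not "finishing BSD". Sub-cell
`b2b-bsdres-additive-p1` (CLASS-OWNERS row "X3/X4 additive — pot. multiplicative / X3♯(M)"),
generation 3; research route, no claim beyond the stated sub-classes; X3♯(M), X4(M) REMAIN
CONSTRUCTION-SHAPED.

Theorems only; no definition, no new named fact. The `∀ K`-hypothesis forms of `TwistSupply.lean` /
`TwistSupplyRam.lean` are here sharpened to their honest shape — an EXISTENTIAL over the field and an
EQUIVALENCE with the target (gen 2's exactness `missingPPartOverCAt_baseChange_iff_bsdp`):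

* **`ClassX3M.exists_quadraticField_bsdp_iff`** — for EVERY `(E,p) ∈ X3♯(M)` of analytic rank `≤ 1`
  there is a quadratic field `K` (explicitly: one whose twist `E^{(d_K)}` has a globally minimal model
  that is multiplicative at `p`, gvpar, of analytic rank `0`) such that
  **`MissingPPartOverCAt (W.baseChange K) p ↔ BSDp W p`** — granted the published binders of the X2a
  closure (Greenberg–Vatsal 2000 [flag `GV00-mult-asserted`], Wuthrich 2014 Thm. 16, Stein–Wuthrich
  2013, Greenberg–Stevens), Milne 1972 any-model, GZK, modularity and Hoffstein–Luo 1997.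
* **`ClassX4M.exists_quadraticField_bsdp_iff_of_ram`** — the same for every `(E,p) ∈ X4(M) ∧ (ram)`
  of analytic rank `≤ 1` (twist closed by Skinner 2016 Thm. C), the field's twist being in addition
  irreducible at `p` with (ram).

Reading: the `p`-part of BSD for these classes is, pair by pair, the SAME PROPOSITION as the
`p`-part of BSD for `E` over one explicit kind of quadratic field (ramified at `p`, `E_K`
multiplicative above `p`) — no stronger and no weaker. Printed nowhere (REPORT §4, §6.3, §7).
-/

noncomputable section

open scoped Classical

open WeierstrassCurve Literature.NumberTheory.EllipticCurves
  Literature.NumberTheory.EllipticCurves.ModularForms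
  Literature.NumberTheory.EllipticCurves.Rank1Residual
  Literature.NumberTheory.EllipticCurves.Rank1Residual.Typed
  Literature.NumberTheory.EllipticCurves.GreenbergVatsal2000
  Literature.NumberTheory.EllipticCurves.Wuthrich2014
  Literature.NumberTheory.EllipticCurves.SteinWuthrich2013

namespace Summit.BirchSwinnertonDyer.Rank1Residual.AdditivePotMult

variable {W : WeierstrassCurve ℚ} [W.IsElliptic] {p : ℕ} [Fact p.Prime]

/-- **X3♯(M): one quadratic field over which `BSD(E,p)` ⟺ the over-`K` input — for every pair.**
For `(E,p) ∈ X3♯(M)` (`W` globally minimal) of analytic rank `≤ 1` there is a quadratic field `K`,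
together with a globally minimal model `Wd` of `E^{(d_K)}` that is multiplicative at `p`, satisfies
gvpar and has analytic rank `0`, such that `MissingPPartOverCAt (W.baseChange K) p ↔ BSDp W p`.
Proof: `ClassX3M.exists_gvPar_rankZero_mult_twist` (twist supply), the X2a closure for the twist
(`bsdp_twist_of_rankZero_gvPar`, binders `hGV hWu hJs hJn hHs hHn hGS`), and gen 2's exactness
`missingPPartOverCAt_baseChange_iff_bsdp` (Milne any-model `hMilneC`, GZK, modularity).
X3♯(M) stays CONSTRUCTION-SHAPED. [folklore] -/
theorem ClassX3M.exists_quadraticField_bsdp_iff [W.IsGloballyMinimal]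
    (hGV : lambdaMu_multiplicative_of_gvPar)
    (hWu : thm16_charIdeal_dvd_multiplicative_of_reducible)
    (hJs : thm61_splitMultiplicative) (hJn : thm61_nonsplitMultiplicative)
    (hHs : exists_isSplitMultCanonical) (hHn : exists_isMultCanonical)
    (hGZK : rank_eq_analyticRank_of_analyticRank_le_one) (hmod : hasEntireLFunction_rat)
    (hpar : nonempty_modularParametrizationData)
    (hMilneC : Milne1972.bsdQuotient_baseChange_quadratic_anyModel)
    (hnf : exists_isNewformOf) (hHL : HoffsteinLuo1997_exists_twist_L_one_ne_zero)
    (hGS : ∀ (V : WeierstrassCurve ℚ) [V.IsElliptic] [V.IsGloballyMinimal],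
      greenberg_stevens (W := V) (p := p))
    (hX : ClassX3M W p) (hr : W.analyticRank ≤ 1) :
    ∃ (K : Type) (_ : Field K) (_ : NumberField K), Module.finrank ℚ K = 2 ∧
      (∃ (Wd : WeierstrassCurve ℚ) (_ : Wd.IsElliptic) (_ : Wd.IsGloballyMinimal),
        (∃ C : VariableChange ℚ, C • W.quadraticTwist (NumberField.discr K : ℚ) = Wd) ∧
        Mult Wd p ∧ GVPar Wd p ∧ Wd.analyticRank = 0) ∧
      (MissingPPartOverCAt (W.baseChange K) p ↔ BSDp W p) := by
  obtain ⟨K, iF, iN, Wd, iWd, iWdm, h2, hWd, hmult, hgv, hr0⟩ :=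
    hX.exists_gvPar_rankZero_mult_twist hnf hHL
  have hD : (NumberField.discr K : ℚ) ≠ 0 := by exact_mod_cast NumberField.discr_ne_zero K
  obtain ⟨hp2, hred, -⟩ := classX2_twist_of_classX3M hX hD hWd hmult
  have hd : BSDp Wd p :=
    bsdp_twist_of_rankZero_gvPar p Wd hGV hWu hJs hJn hHs hHn hGZK hmod hpar (hGS Wd) hp2 hmult hred
      hgv hr0
  exact ⟨K, iF, iN, h2, ⟨Wd, iWd, iWdm, hWd, hmult, hgv, hr0⟩,
    missingPPartOverCAt_baseChange_iff_bsdp W p K Wd hGZK hmod hMilneC hr h2 hWd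
      (by rw [hr0]; exact zero_le_one) hd⟩

/-- **X4(M) ∧ (ram): one quadratic field over which `BSD(E,p)` ⟺ the over-`K` input — for every
pair.** For `(E,p) ∈ X4(M)` (`W` globally minimal) of analytic rank `≤ 1` with `Ram W p` there is a
quadratic field `K`, together with a globally minimal model `Wd` of `E^{(d_K)}` that is multiplicative
and irreducible at `p`, satisfies (ram) and has analytic rank `0`, such that
`MissingPPartOverCAt (W.baseChange K) p ↔ BSDp W p`. Proof: `ClassX4M.exists_ram_rankZero_mult_twist`
(twist supply with the `q`-adic adjustment), Skinner 2016 Thm. C for the twist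
(`bsdp_twist_of_rankZero_ram`, `hSk`), and gen 2's `missingPPartOverCAt_baseChange_iff_bsdp`.
X4(M) stays CONSTRUCTION-SHAPED. [folklore] -/
theorem ClassX4M.exists_quadraticField_bsdp_iff_of_ram [W.IsGloballyMinimal]
    (hGZK : rank_eq_analyticRank_of_analyticRank_le_one) (hmod : hasEntireLFunction_rat)
    (hMilneC : Milne1972.bsdQuotient_baseChange_quadratic_anyModel)
    (hSk : Skinner2016.thmC_padicValRat_bsd_rank_zero)
    (hnf : exists_isNewformOf) (hHL : HoffsteinLuo1997_exists_twist_L_one_ne_zero)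
    (hX : ClassX4M W p) (hr : W.analyticRank ≤ 1) (hram : Ram W p) :
    ∃ (K : Type) (_ : Field K) (_ : NumberField K), Module.finrank ℚ K = 2 ∧
      (∃ (Wd : WeierstrassCurve ℚ) (_ : Wd.IsElliptic) (_ : Wd.IsGloballyMinimal),
        (∃ C : VariableChange ℚ, C • W.quadraticTwist (NumberField.discr K : ℚ) = Wd) ∧
        Mult Wd p ∧ Irr Wd p ∧ Ram Wd p ∧ Wd.analyticRank = 0) ∧
      (MissingPPartOverCAt (W.baseChange K) p ↔ BSDp W p) := by
  obtain ⟨K, iF, iN, Wd, iWd, iWdm, h2, hWd, hmult, hirr, hramd, hr0⟩ :=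
    hX.exists_ram_rankZero_mult_twist hram hnf hHL
  have hd : BSDp Wd p := bsdp_twist_of_rankZero_ram p Wd hSk hGZK hmod hX.p_ne_two hmult hirr hramd hr0
  exact ⟨K, iF, iN, h2, ⟨Wd, iWd, iWdm, hWd, hmult, hirr, hramd, hr0⟩,
    missingPPartOverCAt_baseChange_iff_bsdp W p K Wd hGZK hmod hMilneC hr h2 hWd
      (by rw [hr0]; exact zero_le_one) hd⟩

end Summit.BirchSwinnertonDyer.Rank1Residual.AdditivePotMult

end
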